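import Literature.NumberTheory.EllipticCurves.HeegnerPointsKolyvaginPrimaryProp82Proofs
import Summits.BirchSwinnertonDyer.BirchSwinnertonDyer.Theorems.KolyvaginDepthDoorKolyvaginDepthSupplyZhangGrossPow
import Literature.NumberTheory.EllipticCurves.McCallum1991.KolyvaginClassesLocalLeaves
import HarnessLib

/-!
# Route `KolyvaginDepthDoor`, crux `KolyvaginDepthSupply` (stmt-BirchSwinnertonDyer-21765) —
# LEAF 4 OF THE hF-FREE DOOR DISCHARGED AT EVERY LEVEL: `McCallum1991.lemma53_selmer_eigen_dependent_at`
# (McCallum 1991 Lemma 5.3 / Gross 1991 Prop. 8.1 (1) at level `p^M`: two Selmer `ν`-eigenclasses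
# are dependent at a Kolyvagin place of level `M`) HOLDS

Helper file (`--supports stmt-BirchSwinnertonDyer-21765 --as helper`); it closes nothing and BSD is
not proved by it.

`…LeafEigenLine` (this seat) proved the leaf at `M = 1`; here it is proved AS STATED (every `M`):
at a Kolyvagin prime of level `M` (Gross (3.2) mod `p^M`, from W. Zhang's index by
`frobEqFrobInfty_pow_of_zhang`) Steps 0–4 and 8 of the tree's `lemma_5_3_descent_of_reciprocity`
(lift `T` of `c`, Frobenius `τ'` at `𝔔 ∣ λ` with `res τ' = h²` fixing `E_{p^M}`, `ν`-eigen Frobenius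
values, McCallum's count `KolyvaginEigenPow.exists_eigen_generators`: both eigen-parts of `E_{p^M}`
CYCLIC of order `p^M`) put `[s₁, τ']`, `[s₂, τ']` in one cyclic `ℤ g`, `p^M g = 0`; a `p`-adic
valuation argument gives `a [s₁, τ'] + b [s₂, τ'] = 0` with `(a, b) ≢ (0, 0) (mod p)`, and Gross's
Prop. 9.6 at the prime of `λ` cut out by the embedding (transported by `h1Eval_conj`) concludes.

* `exists_zsmul_add_zsmul_eq_zero_of_mem_zmultiples` (two elements of a cyclic `ℤ g`, `p^M g = 0`,
  are dependent mod `p`); `exists_zsmul_add_zsmul_mem_torsionLocalKer_of_eigen_pow` (Gross currency,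
  level `q = p^M`); `lemma53_selmer_eigen_dependent_at_holds` — **the leaf HOLDS** (`¬ CM` idle).
With `…LeafSign` and `…LeafReciprocityPow`, THREE of the five McCallum leaves are theorems AS STATED;
`h43` is F1 (`…LeafLocalPow`), `h44` is (γ). Nothing is asserted about any curve; BSD is not proved.
References: [McCallumLMS1991] §4, §5 Lemma 5.3; [GrossLMS1991] §3 (3.2), Prop. 8.1 (1), Prop. 9.6.
-/

set_option linter.dupNamespace false

noncomputable section

open scoped Classical Pointwise

namespace Summit.BirchSwinnertonDyer.BirchSwinnertonDyer.Theorems.KolyvaginDepthDoor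

open WeierstrassCurve NumberField IsDedekindDomain Field WithZero
open Literature.NumberTheory.EllipticCurves Literature.NumberTheory.EllipticCurves.McCallum1991
open Literature.NumberTheory.GaloisRepresentations
open Summit.BirchSwinnertonDyer.Rank1Residual.X11b.Three.Koly.Method2

universe u

/-! ## Two elements of a cyclic `p`-group are dependent modulo `p` -/

section Cyclic

variable {A : Type*} [AddCommGroup A]

/-- Bézout: for `α = p^e α'` with `p ∤ α'` and `β = p^e β''` there is `γ` with `p^M ∣ γ α − β`.
[folklore] -/
theorem exists_pow_dvd_mul_sub {p : ℕ} (hp : p.Prime) (M : ℕ) {e : ℕ} {α' β'' : ℤ}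
    (hα' : ¬ (p : ℤ) ∣ α') :
    ∃ γ : ℤ, ((p : ℤ) ^ M) ∣ γ * ((p : ℤ) ^ e * α') - (p : ℤ) ^ e * β'' := by
  have hcop : IsCoprime α' ((p : ℤ) ^ M) := by
    refine IsCoprime.pow_right ?_
    rw [Int.isCoprime_iff_gcd_eq_one, Int.gcd_comm]
    have h1 : Int.gcd (p : ℤ) α' = Nat.gcd p α'.natAbs := by simp [Int.gcd]
    rw [h1]
    exact (Nat.Prime.coprime_iff_not_dvd hp).mpr (fun h ↦ hα' (Int.natCast_dvd.mpr h))
  obtain ⟨u, v, huv⟩ := hcop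
  refine ⟨β'' * u, ⟨-((p : ℤ) ^ e * β'' * v), ?_⟩⟩
  linear_combination ((p : ℤ) ^ e * β'') * huv

/-- **Two elements of a cyclic group `ℤ g` with `p^M g = 0` satisfy `a x₁ + b x₂ = 0` with
`(a, b) ≢ (0, 0) (mod p)`**: `xᵢ = αᵢ g`; at the index of smaller `v_p(αᵢ)`, `αᵢ = p^e α'`,
`α_j = p^e β''`, `γ αᵢ ≡ α_j (mod p^M)` with `γ = β'' α'^{-1}`, so `γ xᵢ − x_j = 0`. [folklore] -/
theorem exists_zsmul_add_zsmul_eq_zero_of_mem_zmultiples {p : ℕ} (hp : p.Prime) {M : ℕ} {g : A}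
    (hg : p ^ M • g = 0) {x₁ x₂ : A} (h₁ : x₁ ∈ AddSubgroup.zmultiples g)
    (h₂ : x₂ ∈ AddSubgroup.zmultiples g) :
    ∃ a b : ℤ, ¬ ((p : ℤ) ∣ a ∧ (p : ℤ) ∣ b) ∧ a • x₁ + b • x₂ = 0 := by
  haveI : Fact p.Prime := ⟨hp⟩
  have hp1 : ¬ (p : ℤ) ∣ 1 := fun h ↦ hp.one_lt.ne' (by
    have := Int.eq_one_of_dvd_one (Int.natCast_nonneg p) h
    exact_mod_cast this)
  have hpm1 : ¬ (p : ℤ) ∣ -1 := fun h ↦ hp1 (dvd_neg.mp h)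
  have hgM : ((p : ℤ) ^ M) • g = 0 := by rw [← Nat.cast_pow, natCast_zsmul]; exact hg
  obtain ⟨α, rfl⟩ := AddSubgroup.mem_zmultiples_iff.mp h₁
  obtain ⟨β, rfl⟩ := AddSubgroup.mem_zmultiples_iff.mp h₂
  have hrel : ∀ {α β γ : ℤ}, ((p : ℤ) ^ M) ∣ γ * α - β → γ • α • g + (-1 : ℤ) • β • g = 0 := by
    intro α β γ ⟨k, hk⟩
    rw [smul_smul, smul_smul, ← add_smul, show γ * α + -1 * β = γ * α - β by ring, hk, mul_comm,
      mul_smul, hgM, smul_zero]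
  by_cases hα : α = 0
  · exact ⟨1, 0, fun h ↦ hp1 h.1, by rw [hα]; simp⟩
  by_cases hβ : β = 0
  · exact ⟨0, 1, fun h ↦ hp1 h.2, by rw [hβ]; simp⟩
  have hdec : ∀ {α : ℤ}, α ≠ 0 → ∃ α' : ℤ, α = (p : ℤ) ^ padicValInt p α * α' ∧ ¬ (p : ℤ) ∣ α' := by
    intro α hα0
    obtain ⟨α', hα'⟩ := (padicValInt_dvd_iff (padicValInt p α) α).mpr (Or.inr le_rfl)
    refine ⟨α', hα', fun ⟨t, ht⟩ ↦ ?_⟩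
    have hdvd : (p : ℤ) ^ (padicValInt p α + 1) ∣ α := ⟨t, by
      conv_lhs => rw [hα', ht]
      ring⟩
    rcases (padicValInt_dvd_iff _ α).mp hdvd with h0 | hle
    · exact hα0 h0
    · omega
  rcases le_total (padicValInt p α) (padicValInt p β) with hle | hle
  · obtain ⟨α', hα', hα'p⟩ := hdec hα
    obtain ⟨β'', hβ''⟩ := (padicValInt_dvd_iff (padicValInt p α) β).mpr (Or.inr hle)
    obtain ⟨γ, hγ⟩ := exists_pow_dvd_mul_sub hp M (e := padicValInt p α) (β'' := β'') hα'p
    rw [← hα', ← hβ''] at hγ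
    exact ⟨γ, -1, fun h ↦ hpm1 h.2, hrel hγ⟩
  · obtain ⟨β', hβ', hβ'p⟩ := hdec hβ
    obtain ⟨α'', hα''⟩ := (padicValInt_dvd_iff (padicValInt p β) α).mpr (Or.inr hle)
    obtain ⟨γ, hγ⟩ := exists_pow_dvd_mul_sub hp M (e := padicValInt p β) (β'' := α'') hβ'p
    rw [← hβ', ← hα''] at hγ
    refine ⟨-1, γ, fun h ↦ hpm1 h.1, ?_⟩
    rw [add_comm]; exact hrel hγ

end Cyclic

/-! ## Two Selmer `ν`-eigenclasses are dependent at a Kolyvagin place of level `M` -/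

section Gross

variable {K : Type u} [Field K] [NumberField K] (W : WeierstrassCurve ℚ)

/-- **McCallum 1991 Lemma 5.3 / Gross 1991 Prop. 8.1 (1) for global classes at LEVEL `p^M`, PROVED:
two `ν`-eigenclasses `s₁, s₂ ∈ H¹(K, E[p^M])` satisfying the Selmer condition at the Kolyvagin place
`λ` (of level `M`: `Frob(ℓ) = Frob(∞)` in `Gal(K(E[p^M])/ℚ)`, good reduction at `λ`) admit
`a, b ∈ ℤ`, not both divisible by `p`, with `a s₁ + b s₂ = 0` in `H¹(K_λ, E[p^M])`.** Proof: module
docstring (Steps 0–4, 8 of the tree's `lemma_5_3_descent_of_reciprocity`, then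
`exists_zsmul_add_zsmul_eq_zero_of_mem_zmultiples` in the cyclic `ν`-eigen-part of `E_{p^M}`, then
Gross's Prop. 9.6 transported to the prime of the embedding).
[cite: McCallumLMS1991, §5 Lemma 5.3 (p. 304)] [cite: GrossLMS1991, §8 Prop. 8.1 (1), §9 Prop. 9.6] -/
theorem exists_zsmul_add_zsmul_mem_torsionLocalKer_of_eigen_pow [W.IsElliptic]
    (hK : IsImaginaryQuadratic K) {p : ℕ} (hp : p.Prime) (hp2 : p ≠ 2) {c : K ≃ₐ[ℚ] K} (hc : c ≠ 1)
    {N ℓ : ℕ} (hℓ : IsKolyvaginPrime N W K p ℓ) {M : ℕ} (hM : 1 ≤ M) {q : ℕ} (hq : q = p ^ M)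
    (hℓM : FrobEqFrobInfty W K q ℓ)
    (hgood : (W.baseChange K).HasGoodReductionAt hℓ.place)
    {ν : ℤ} (hν : ν = 1 ∨ ν = -1)
    {s₁ s₂ : galH1Torsion (W.baseChange K) (q : ℤ)}
    (hs₁ : s₁ ∈ selmerLocalKer (W.baseChange K) (hℓ.place.adicCompletion K) (q : ℤ))
    (hτ₁ : conjAct W c (q : ℤ) s₁ = ν • s₁)
    (hs₂ : s₂ ∈ selmerLocalKer (W.baseChange K) (hℓ.place.adicCompletion K) (q : ℤ))
    (hτ₂ : conjAct W c (q : ℤ) s₂ = ν • s₂) :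
    ∃ a b : ℤ, ¬ ((p : ℤ) ∣ a ∧ (p : ℤ) ∣ b) ∧
      a • s₁ + b • s₂ ∈ (W.baseChange K).torsionLocalKer (hℓ.place.adicCompletion K) (q : ℤ) := by
  classical
  haveI : Fact p.Prime := ⟨hp⟩
  haveI : Algebra.IsQuadraticExtension ℚ K := ⟨hK.1⟩
  haveI : IsTotallyComplex K := hK.2
  set w := hℓ.place with hwdef
  have hℓprime : ℓ.Prime := hℓ.prime
  have hq0 : q ≠ 0 := by rw [hq]; exact pow_ne_zero M hp.ne_zero
  have hq0Z : (q : ℤ) ≠ 0 := by exact_mod_cast hq0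
  -- ### Step 0: `p, q ∉ λ`, `λ` good, `#E_q = q²`, `q E_q = 0`
  have hpw' : (p : 𝓞 K) ∉ w.asIdeal :=
    not_natCast_mem_of_prime_ne hℓprime hp hℓ.2.2.2.1 w hℓ.mem_place
  have hqw' : (q : 𝓞 K) ∉ w.asIdeal := by
    rw [hq, Nat.cast_pow]
    exact fun h ↦ hpw' (w.isPrime.mem_of_pow_mem M h)
  have hqw : (((q : ℕ) : ℤ) : 𝓞 K) ∉ w.asIdeal := by rwa [Int.cast_natCast]
  have hwbad : w ∉ (W.baseChange K).badPlaces (𝓞 K) := fun h ↦ h hgood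
  have hTq : ∀ P : geomTorsion (W.baseChange K) q, q • P = 0 := fun P ↦ by
    have := (mem_geomTorsion_iff (W.baseChange K) q _).mp P.2
    apply Subtype.ext
    rw [AddSubgroupClass.coe_nsmul, ← natCast_zsmul]
    exact this
  have hcardK : Nat.card (geomTorsion (W.baseChange K) q) = q ^ 2 :=
    card_torsionPoints_eq_sq_holds (W.baseChange K) (AlgebraicClosure K)
      (by exact_mod_cast hq0)
  -- ### Step 1: the Frobenius data of (3.2)
  obtain ⟨v, 𝔓₀, h, c₀, hℓv, h𝔓₀, hh, hc₀, hE, hKact⟩ := hℓM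
  have hHi := index_range_absGaloisRestrict_eq_finrank ℚ K
  haveI hHn : ((absGaloisRestrict ℚ K).range).Normal :=
    Subgroup.normal_of_index_eq_two (hHi.trans hK.1)
  set e₀ : K →ₐ[ℚ] AlgebraicClosure ℚ :=
    (Literature.NumberTheory.EllipticCurves.absClosureEquiv ℚ K).symm.toAlgHom.comp
      (IsScalarTower.toAlgHom ℚ K (AlgebraicClosure K)) with he₀
  have he₀x : ∀ x : K, e₀ x = (Literature.NumberTheory.EllipticCurves.absClosureEquiv ℚ K).symm
      (algebraMap K (AlgebraicClosure K) x) := fun _ ↦ rfl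
  have hrange : ∀ γ : absoluteGaloisGroup ℚ,
      γ ∈ Set.range (absGaloisRestrict ℚ K) ↔ ∀ x : K, γ • e₀ x = e₀ x := fun γ ↦ by
    rw [mem_range_absGaloisRestrict_iff]
    refine forall_congr' fun x ↦ ?_
    rw [absGaloisTransport_apply, he₀x]
    constructor
    · intro h1
      apply (Literature.NumberTheory.EllipticCurves.absClosureEquiv ℚ K).injective
      rw [AlgEquiv.apply_symm_apply]
      exact h1
    · intro h1
      rw [h1, AlgEquiv.apply_symm_apply]
  have hc₀H : c₀ ∉ Set.range (absGaloisRestrict ℚ K) :=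
    hc₀.not_mem_range_absGaloisRestrict (L := K) IsTotallyComplex.isComplex
  have hhH : h ∉ (absGaloisRestrict ℚ K).range := by
    intro hmem
    have hmem' : h ∈ Set.range (absGaloisRestrict ℚ K) := hmem
    apply hc₀H
    rw [hrange]
    intro x
    rw [← hKact e₀ x]
    exact (hrange h).mp hmem' x
  -- ### Step 2: `ℓ` unramified; the prime `𝔔 ∣ λ` and the Frobenius `τ'` with `res τ' = h²`
  have hunr : Algebra.IsUnramifiedIn (𝓞 K) v.asIdeal :=
    isUnramifiedIn_of_span_natCast_isPrime hℓprime hℓ.2.2.2.2.1 hℓv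
  have hIr := inertia_le_range_absGaloisRestrict_of_isUnramifiedIn (K := K) hunr h𝔓₀
  obtain ⟨w', 𝔔, τ', hw'v, -, -, h𝔔w, -, hτ', hresτ'⟩ :=
    exists_place_inert_of_not_mem_range (F := ℚ) (M := K) (hK.1 ▸ Nat.prime_two) hHn
      (hHi.trans rfl) hunr h𝔓₀ hIr hh hhH
  have hℓw' : (ℓ : 𝓞 K) ∈ w'.asIdeal := by
    have h1 : (ℓ : 𝓞 ℚ) ∈ (w'.under (𝓞 ℚ)).asIdeal := by rw [hw'v]; exact hℓv
    rw [HeightOneSpectrum.under_asIdeal, Ideal.under_def, Ideal.mem_comap, map_natCast] at h1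
    exact h1
  have hw'w : w' = w := hℓ.mem_iff.mp hℓw'
  subst hw'w
  rw [hK.1] at hresτ'
  haveI : 𝔔.IsPrime := h𝔔w.1
  -- ### Step 3: the lift `T = e h e⁻¹` of `c`; `τ'` acts on `K̄` as `T²` and fixes `E_q`
  set T := (absGaloisTransport (K := ℚ) (L := K)) h with hTdef
  have hTne : T.restrictNormal K ≠ 1 := by
    intro h1
    apply hhH
    change h ∈ Set.range (absGaloisRestrict ℚ K)
    rw [mem_range_absGaloisRestrict_iff]
    intro x
    have hx := AlgEquiv.restrictNormal_commutes T K x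
    rw [h1, AlgEquiv.one_apply] at hx
    exact hx.symm
  have ht : IsLiftOfAut c T.toRingEquiv := by
    have hcard : Nat.card (K ≃ₐ[ℚ] K) = 2 := by rw [IsGalois.card_aut_eq_finrank, hK.1]
    obtain ⟨y, -, hy⟩ := (Nat.card_eq_two_iff' (1 : K ≃ₐ[ℚ] K)).mp hcard
    rw [hy c hc, ← hy _ hTne]
    exact RatClosure.isLiftOfAut_restrictNormal_absGaloisTransport h
  have hτ'T : ∀ y : AlgebraicClosure K, (τ' : absoluteGaloisGroup K) • y = T (T y) := fun y ↦ by
    rw [← absGaloisTransport_absGaloisRestrict (K := ℚ) τ' y, hresτ', map_pow, pow_two,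
      AlgEquiv.mul_apply]
  have hτ'fix : τ' ∈ torsionFixing (W.baseChange K) q := by
    rw [mem_torsionFixing_iff]
    intro Q
    obtain ⟨P, rfl⟩ := (RatClosure.torsionEquiv (K := K) W (q : ℤ)).surjective Q
    rw [← RatClosure.torsionEquiv_smul W q τ' P, hresτ', pow_two, mul_smul, hE, hE,
      ← mul_smul, ← pow_two, hc₀.sq_eq_one, one_smul]
  -- ### Step 4: `conj_T τ' = τ'` and `T_*[sᵢ, τ'] = ν [sᵢ, τ']`
  have hconjτ' : ht.conjGalCMH τ' = τ' := by
    refine AlgEquiv.ext fun y ↦ ?_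
    change ht.conjGal τ' y = _
    rw [ht.conjGal_apply]
    change T.symm ((τ' : absoluteGaloisGroup K) • (T y)) = (τ' : absoluteGaloisGroup K) • y
    rw [hτ'T, hτ'T, AlgEquiv.symm_apply_apply]
  have hs₁_eigen : ht.torsionMap W q (h1Eval (W.baseChange K) q s₁ τ') =
      ν • h1Eval (W.baseChange K) q s₁ τ' :=
    torsionMap_h1Eval_eq_of_conjAct_eq W ht q hτ'fix hconjτ' hτ₁
  have hs₂_eigen : ht.torsionMap W q (h1Eval (W.baseChange K) q s₂ τ') =
      ν • h1Eval (W.baseChange K) q s₂ τ' :=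
    torsionMap_h1Eval_eq_of_conjAct_eq W ht q hτ'fix hconjτ' hτ₂
  -- ### Step 8: `E_q = E_q⁺ ⊕ E_q⁻` with both parts cyclic of order `q` (McCallum Lemma 5.3)
  set ι := ht.torsionMap W q with hιdef
  set θq := RatClosure.torsionEquiv (K := K) W (q : ℤ) with hθq
  have hιθ : ∀ P : geomTorsion W q, ι (θq P) = θq (c₀ • P) := fun P ↦ by
    rw [← hE, ← RatClosure.torsionEquiv_smul_of_lift W ht h (fun _ ↦ rfl) q P]
  have hιinv : ∀ Q, ι (ι Q) = Q := fun Q ↦ by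
    obtain ⟨P, rfl⟩ := θq.surjective Q
    rw [hιθ, hιθ, ← mul_smul, ← pow_two, hc₀.sq_eq_one, one_smul]
  have hpq : p ∣ q := hq ▸ dvd_pow_self p (by omega)
  have hEp : ∀ P : geomTorsion W p, h • P = c₀ • P := fun P ↦ by
    have hPq : ((q : ℕ) : ℤ) • (P : geomPoints W) = 0 := by
      obtain ⟨m, hm⟩ := hpq
      rw [hm, Nat.cast_mul, mul_comm, mul_smul, (mem_geomTorsion_iff W p _).mp P.2, smul_zero]
    have h1 := congrArg Subtype.val (hE ⟨P.1, (mem_geomTorsion_iff W q _).mpr hPq⟩)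
    rw [AddSubgroup.torsionBy.coe_smul, AddSubgroup.torsionBy.coe_smul] at h1
    apply Subtype.ext
    rw [AddSubgroup.torsionBy.coe_smul, AddSubgroup.torsionBy.coe_smul]
    exact h1
  obtain ⟨⟨e₁, he₁0, he₁⟩, ⟨e₂, he₂0, he₂⟩⟩ :=
    RatClosure.exists_eigenvectors W hc₀ (W.exists_weilPairing_holds p) hp2
  set θp := RatClosure.torsionEquiv (K := K) W (p : ℤ) with hθp
  have hinclmem : ∀ Q : geomTorsion (W.baseChange K) p,
      ((q : ℕ) : ℤ) • (Q : geomPoints (W.baseChange K)) = 0 := fun Q ↦ by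
    obtain ⟨m, hm⟩ := hpq
    rw [hm, Nat.cast_mul, mul_comm, mul_smul, (mem_geomTorsion_iff _ p _).mp Q.2, smul_zero]
  set incl : geomTorsion (W.baseChange K) p → geomTorsion (W.baseChange K) q :=
    fun Q ↦ ⟨Q.1, (mem_geomTorsion_iff _ q _).mpr (hinclmem Q)⟩ with hincl
  have hincl_inj : Function.Injective incl := fun Q Q' hQ ↦ Subtype.ext
    (congrArg (fun R : geomTorsion (W.baseChange K) (q : ℤ) ↦ (R : geomPoints (W.baseChange K)))
      hQ)
  have hincl0 : incl 0 = 0 := Subtype.ext rfl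
  have hincl_neg : ∀ Q, incl (-Q) = -incl Q := fun Q ↦ Subtype.ext rfl
  have hincl_p : ∀ Q, p • incl Q = 0 := fun Q ↦ Subtype.ext (by
    rw [AddSubgroupClass.coe_nsmul, ZeroMemClass.coe_zero]
    change p • (Q : geomPoints (W.baseChange K)) = 0
    rw [← natCast_zsmul]
    exact (mem_geomTorsion_iff _ p _).mp Q.2)
  have hιincl : ∀ Q, ι (incl Q) = incl (ht.torsionMap W p Q) := fun Q ↦ by
    apply Subtype.ext
    simp only [hincl, hιdef, IsLiftOfAut.coe_torsionMap]
  have hθpT : ∀ P : geomTorsion W p, ht.torsionMap W p (θp P) = θp (c₀ • P) := fun P ↦ by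
    rw [← hEp, ← RatClosure.torsionEquiv_smul_of_lift W ht h (fun _ ↦ rfl) p P]
  set v₁ := incl (θp e₁) with hv₁def
  set v₂ := incl (θp e₂) with hv₂def
  have hv₁ : ι v₁ = v₁ := by rw [hv₁def, hιincl, hθpT, he₁]
  have hv₂ : ι v₂ = -v₂ := by rw [hv₂def, hιincl, hθpT, he₂, map_neg, hincl_neg]
  have hv₁0 : v₁ ≠ 0 := fun h0 ↦ he₁0 (θp.injective (hincl_inj (by
    rw [map_zero, hincl0]; exact h0)))
  have hv₂0 : v₂ ≠ 0 := fun h0 ↦ he₂0 (θp.injective (hincl_inj (by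
    rw [map_zero, hincl0]; exact h0)))
  have hcardKp : Nat.card (geomTorsion (W.baseChange K) p) = p ^ 2 :=
    card_torsionPoints_eq_sq_holds (W.baseChange K) (AlgebraicClosure K)
      (by exact_mod_cast hp.ne_zero)
  have hcardp : Nat.card {x : geomTorsion (W.baseChange K) q // p • x = 0} = p ^ 2 := by
    refine Eq.trans (Nat.card_congr ?_) hcardKp
    exact
      { toFun := fun x ↦ ⟨x.1.1, (mem_geomTorsion_iff _ p _).mpr (by
          have h1 := congrArg Subtype.val x.2
          rw [AddSubgroupClass.coe_nsmul, ZeroMemClass.coe_zero, ← natCast_zsmul] at h1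
          exact h1)⟩
        invFun := fun Q ↦ ⟨incl Q, hincl_p Q⟩
        left_inv := fun x ↦ Subtype.ext (Subtype.ext rfl)
        right_inv := fun Q ↦ Subtype.ext rfl }
  have hcardT : Nat.card (geomTorsion (W.baseChange K) q) = p ^ (2 * M) := by
    rw [hcardK, hq, ← pow_mul, mul_comm]
  have hTp' : ∀ t : geomTorsion (W.baseChange K) q, p ^ M • t = 0 := fun t ↦ by
    rw [← hq]; exact hTq t
  haveI : Finite (geomTorsion (W.baseChange K) q) :=
    Nat.finite_of_card_ne_zero (by rw [hcardT]; exact pow_ne_zero _ hp.ne_zero)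
  obtain ⟨u₀, w₀, -, -, hPu, hQw, -, hou, how⟩ :=
    KolyvaginEigenPow.exists_eigen_generators hp hp2 hTp' hcardT hcardp ι hιinv hv₁0
      (hincl_p _) hv₁ hv₂0 (hincl_p _) hv₂
  set x₁ := h1Eval (W.baseChange K) q s₁ τ' with hx₁def
  set x₂ := h1Eval (W.baseChange K) q s₂ τ' with hx₂def
  obtain ⟨a, b, hab, hrel⟩ : ∃ a b : ℤ, ¬ ((p : ℤ) ∣ a ∧ (p : ℤ) ∣ b) ∧ a • x₁ + b • x₂ = 0 := by
    rcases hν with rfl | rfl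
    · rw [one_smul] at hs₁_eigen hs₂_eigen
      exact exists_zsmul_add_zsmul_eq_zero_of_mem_zmultiples hp (hTp' u₀) (hPu x₁ hs₁_eigen)
        (hPu x₂ hs₂_eigen)
    · rw [neg_one_zsmul] at hs₁_eigen hs₂_eigen
      exact exists_zsmul_add_zsmul_eq_zero_of_mem_zmultiples hp (hTp' w₀) (hQw x₁ hs₁_eigen)
        (hQw x₂ hs₂_eigen)
  refine ⟨a, b, hab, ?_⟩
  set s' := a • s₁ + b • s₂ with hs'def
  have hs' : s' ∈ selmerLocalKer (W.baseChange K) (w.adicCompletion K) (q : ℤ) :=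
    AddSubgroup.add_mem _ (AddSubgroup.zsmul_mem _ hs₁ a) (AddSubgroup.zsmul_mem _ hs₂ b)
  have hxs' : h1Eval (W.baseChange K) q s' τ' = 0 := by
    rw [hs'def, h1Eval_add _ _ _ _ hτ'fix, h1Eval_zsmul _ _ _ _ hτ'fix, h1Eval_zsmul _ _ _ _ hτ'fix,
      ← hx₁def, ← hx₂def, hrel]
  haveI : CharZero (w.adicCompletion K) :=
    charZero_of_injective_algebraMap (algebraMap K (w.adicCompletion K)).injective
  obtain ⟨𝔐, h𝔐⟩ := w.localPrimesAbove_nonempty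
  set 𝔓w := w.primeBelow (closureEmb (K := K) (w.adicCompletion K)) 𝔐 with h𝔓wdef
  have h𝔓w : 𝔓w ∈ w.primesAbove := HeightOneSpectrum.primeBelow_mem_primesAbove h𝔐
  obtain ⟨δ, -, hF⟩ :=
    HeightOneSpectrum.exists_isArithFrobAt_conj_of_mem_primesAbove_holds h𝔔w h𝔓w hτ'
  have hFT : δ * τ' * δ⁻¹ ∈ torsionFixing (W.baseChange K) q :=
    (torsionFixing_normal (W.baseChange K) q).conj_mem _ hτ'fix δ
  have hsunr : s' ∈ unramifiedKer (geomTorsion (W.baseChange K) q) 𝔓w :=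
    selmerLocalKer_le_unramifiedKer (HeightOneSpectrum.exists_mem_inertia_apply_eq_holds w)
      (W.baseChange K).smul_localPoints_eq_of_mem_inertia_holds hwbad hqw h𝔓w hs'
  have hcrit := mem_torsionLocalKer_iff_h1Eval_eq_zero (W.baseChange K) (q : ℤ) h𝔐 hF hFT
    (inertia_le_torsionFixing (W.baseChange K) hwbad hqw _ h𝔐)
    (isOpen_torsionFixing (W.baseChange K) hq0Z)
    (torsionPointsMap_bijective (W.baseChange K) (w.adicCompletion K) hq0).2 hsunr
  change s' ∈ _
  rw [hcrit, h1Eval_conj (W.baseChange K) q s' δ hτ'fix, hxs', smul_zero]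

end Gross

section Leaf

/-- **LEAF 4 DISCHARGED: `McCallum1991.lemma53_selmer_eigen_dependent_at` HOLDS** (McCallum 1991
Lemma 5.3 *"a duality of cyclic groups of order `p^M`"* / Gross 1991 Prop. 8.1 (1), recorded as: two
classes of `Sel_{p^M}(E/K)` in one eigenspace of complex conjugation are dependent in
`H¹(K_λ, E_{p^M})` at a Zhang–Kolyvagin prime of index `≥ M`). Proof:
`exists_zsmul_add_zsmul_mem_torsionLocalKer_of_eigen_pow` at Gross's currency, reached from Zhang's by
`isKolyvaginPrime_and_frobEqFrobInfty_pow_of_zhang` (tower surjectivity at `1` and `M`), good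
reduction at `ℓ ∤ N_E` (`LocalFrob.hasGoodReductionAt_rat_of_not_dvd_conductorNorm`, base-changed),
`v = λ` by `IsKolyvaginPrime.mem_iff`. Unconditional; the leaf's `¬ CM` binder is idle.
[cite: McCallumLMS1991, §5 Lemma 5.3 (p. 304)] [cite: GrossLMS1991, §8 Prop. 8.1 (1)]
[cite: WZhang2014, Notations (xii)] -/
theorem lemma53_selmer_eigen_dependent_at_holds : lemma53_selmer_eigen_dependent_at := by
  intro W _ _ _ _hcm K _ _ hK p _ hp2 htower c hc M hM ℓ hℓ hℓM ν hν s₁ hs₁ hτ₁ s₂ hs₂ hτ₂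
  have hp : p.Prime := Fact.out
  have hρ : W.HasSurjectiveModNGaloisRep p := by simpa only [pow_one] using htower 1
  obtain ⟨hℓG, hfrob⟩ :=
    isKolyvaginPrime_and_frobEqFrobInfty_pow_of_zhang W K hK hp2 hM hρ (htower M) hℓ hℓM
  have hgood : (W.baseChange K).HasGoodReductionAt hℓG.place := by
    haveI : hℓG.place.asIdeal.LiesOver (hℓG.place.under (𝓞 ℚ)).asIdeal := ⟨rfl⟩
    exact hasGoodReductionAt_baseChange_of_hasGoodReductionAt_rat W (hℓG.place.under (𝓞 ℚ))
      hℓG.place (LocalFrob.hasGoodReductionAt_rat_of_not_dvd_conductorNorm W hℓG.prime hℓG.2.1 _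
        hℓG.natCast_mem_under)
  obtain ⟨a, b, hab, hmem⟩ := exists_zsmul_add_zsmul_mem_torsionLocalKer_of_eigen_pow W hK hp hp2
    hc hℓG hM (q := p ^ M) rfl hfrob hgood hν
    (((mem_selmerGroup_iff (W.baseChange K) _ s₁).mp hs₁).1 _) hτ₁
    (((mem_selmerGroup_iff (W.baseChange K) _ s₂).mp hs₂).1 _) hτ₂
  refine ⟨a, b, hab, fun v hv ↦ ?_⟩
  have hveq : v = hℓG.place := hℓG.mem_iff.mp hv
  subst hveq
  exact_mod_cast hmem

end Leaf

end Summit.BirchSwinnertonDyer.BirchSwinnertonDyer.Theorems.KolyvaginDepthDoor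

end
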